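/-
Origin: expansion seat `planner-pub-hodgecm-mc-theta-3-g4-0`, handover #5 06:05Z md5 54e031fcd576 (220 l.; NEW additive PKG Model leaf; install ONLY after rows #1 `Model/ThetaHolAssembly` 56115101f1fa + #3 `Model/ArchKTypePin` 960431084322 (RUN-34 delta / RUN 35) AND vendored twins T2 `AdelicPiSchwartzBruhatFourierInversion`, T3 `AdelicSchwartzBruhatTensor`, T5 `AdelicTensorStripping` above (tree files as landed; independent of pv07's T8); LEVEL INDEPENDENCE of the (W-ω) read-off under the PURE-TENSOR form of (W-⊗′): `IsArchTensor ρ := ∀ g, ∃ A, ρ g = adelicTensorEnd A LinearMap.id`; `apply_testFun_of_eq_adelicTensorEnd` ((A ⊗ 1)(φ_N Φ) = φ_N (A Φ) at EVERY (x₀, N), via tree `thinCosetTestFunₗ_eq_tmul` + `adelicTensorEnd_apply_tmul`), `IsArchTensor.isArchOnTestFun` (row #3's hypothesis at every (x₀,N)), `IsArchTensor.archReadRep_apply` (read-off = A), `IsArchTensor.archReadRep_eq` (read-offs at (x₀,N), (x₀',N') coincide), model § `ArchKTypeData.ωinf_apply_of_eq_adelicTensorEnd`, CROSS-LEVEL RIGIDITY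 `ArchKTypeData.ωinf_eq_of_isArchTensor (C : ArchKTypeData X k N) (C' : ArchKTypeData X k N') (hι : X.ιinf C.Γ₀ = X.ιinf C'.Γ₀) (h : IsArchTensor (archRestr X k C.Γ₀)) : C.ωinf = C'.ωinf`, `isArchOnTestFun_archRestr_of_isArchTensor`; §3 TRANSFER of E's one-sided binders to the archimedean factor: `ArchKTypeData.isWeaklyPDiff_of_ωinf_eq` / `isPMinusKilled_of_ωinf_eq` (along any pointwise `C.ωinf (e b) Φ = ρ (e b) Φ`), `isWeaklyPDiff_of_eq_adelicTensorEnd (A) (hA : ∀ g, archRestr X k C.Γ₀ g = adelicTensorEnd (A g) LinearMap.id) (h : ∀ (T : 𝓢 →L[ℂ] ℂ) Φ, DifferentiableAt ℝ (fun b => T (A (e b) Φ)) 0) : C.IsWeaklyPDiff e` (the (AN) socket for theta-1's AN-D `differentiableAt_weilDatum_mul_expP` at y = 1, T ∘ transport), `isPMinusKilled_of_eq_adelicTensorEnd` (the (REP) socket); loose rc 0 / 0 warnings against BOTH mirrors (`work/check-ArchKTypePinTensor-54e031fcd576.log`), private olean rc 0 (431344 B), `#print axioms` ×10 = {propext, Classical.choice,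 Quot.sound} (`work/axioms-ArchKTypePinTensor-54e031fcd576.log`); 0 records / 0 cites / 1 `def … : Prop` (`IsArchTensor`, the displayed formula); MODEL-N ±0) (`HOME/mc/pub-hodgecm-mc-theta-3-g4/lean/stage/HodgeCM/Model/ArchKTypePinTensor.lean`, md5 54e031fc, 220 lines);
landed by the gen-11 packager (p-g11) in gate run 35 as `HodgeCM/Model/ArchKTypePinTensor.lean` (verbatim).
-/
/-
Copyright: pub-hodgecm construction cell (theta-3 lineage, gen 4). PKG Model leaf — node W6a/W6b, field (W-ω) of E's
binder `C : ArchKTypeData`: LEVEL-INDEPENDENCE of the read-off under the pure-tensor form of (W-⊗′).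

STATUS: kernel-checked, zero placeholders. CHECK OF RECORD: loose `lake env lean` against the RUN-33/34 package plus
private oleans of row #3 (`Model/ArchKTypePin` 960431084322) and of the vendored twins
`HodgeCM/Vendored/H21/NumberTheory/Automorphic/{AdelicSchwartzBruhatTensor, AdelicPiSchwartzBruhatFourierInversion,
AdelicTensorStripping}` (manifest `twins-h1-manifest.txt`, T2/T3/T5).

PREREQUISITES (packager, RUN 35+): rows #1 `Model/ThetaHolAssembly`, #3 `Model/ArchKTypePin`; vendored twins T2, T3,
T5 of the manifest.
-/
import Summits.HodgeConjecture.HodgeCM.Model.ArchKTypePin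
import Summits.HodgeConjecture.HodgeCM.Model.ThetaHolAssembly_2
import Literature.NumberTheory.Automorphic.AdelicTensorStripping

/-!
# Node W6a/W6b — the archimedean action read off a PURE-TENSOR restriction is ONE representation for all levels

Row #3 (`Model/ArchKTypePin`) reads the archimedean action `ωinf` of an `ArchKTypeData X k N` off the pair action
restricted along `ιinf Γ₀` (`archRestr X k Γ₀`), at ONE base point and level `(x₀, N)`: the thin cosets
`Φ_∞ ⊗ 1_{x₀ + N𝒪̂^J}` at a fixed `(x₀, N)` do not span `𝒮(𝔸_K^J)`, so (W-⊗′) `prodN` alone does NOT compare the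
read-offs at two levels `N ≠ N'`.

The honest adelic side has more structure: `𝒮(𝔸_K^J) = 𝓢(X_∞) ⊗ 𝒮(X_f)` (harness-tree `piSchwartzBruhatEquiv`,
`AdelicSchwartzBruhatTensor`) and the archimedean component of a product group acts on the archimedean factor only,
`ρ(g) = A_g ⊗ 1` (`adelicTensorEnd A 1`; e.g. `adelicRep_inl_apply_tmul` for `adelicRep ω_∞ ω_f`).  Under that
ONE `Prop` about the restricted action — `IsArchTensor ρ := ∀ g, ∃ A, ρ g = adelicTensorEnd A LinearMap.id` —

* `IsArchTensor.isArchOnTestFun` : row #3's hypothesis holds at EVERY `(x₀, N)` (the thin-coset test function is the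
  pure tensor `Φ_∞ ⊗ 1_{N𝒪̂}(−x₀ + ·)`, tree `thinCosetTestFunₗ_eq_tmul`);
* `IsArchTensor.archReadRep_apply` : the read-off at any `(x₀, N)` IS `A_g` (row #3 `archReadRep_unique`), hence
* `IsArchTensor.archReadRep_eq` : the read-offs at `(x₀, N)` and `(x₀', N')` coincide — LEVEL INDEPENDENCE;
* `ArchKTypeData.ωinf_eq_of_isArchTensor` : two archimedean `K`-type data over the same `X, k` at levels `N, N'`
  whose archimedean inclusions agree (`X.ιinf C.Γ₀ = X.ιinf C'.Γ₀`; `rfl` at the v2 pin) have the SAME `ωinf`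
  as soon as the restricted pair action is pure-tensor along that inclusion.

§3 transfers E's one-sided binders (AN) `IsWeaklyPDiff` and (REP) `IsPMinusKilled` of `C` (row #1
`Model/ThetaHolAssembly`) to the SAME statements about any operator family `ρ` that `C.ωinf` agrees with
pointwise — in particular about the archimedean tensor factor `A_g` — so that the (AN) lane's differentiability
theorem for the archimedean Weil datum (theta-1, `differentiableAt_weilDatum_mul_expP`, transported to
`𝓢((J → K_∞), ℂ)` through a continuous linear equivalence) discharges `hd` for such `C` by one application.

BINDER-TRIAGE reading: with the pure-tensor form of (W-⊗′) (a property of the DATA `S`, satisfied by construction by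
an honest adelic side built as `adelicRep ω_∞ ω_f`), the field `C.ωinf` of E's binder `C V c hV hc h6 k hk N hN` is
ONE representation of `U(2,1)` per `(V, c, k)` — independent of `N` (and of `hk, hN, hc, h6`).

No records, no citations as hypotheses; the one `Prop` definition `IsArchTensor` abbreviates the displayed formula.
-/

noncomputable section

open scoped Classical SchwartzMap NumberField TensorProduct
open NumberField.mixedEmbedding IsDedekindDomain Filter
open scoped Topology
open Literature.NumberTheory.Automorphic Literature.NumberTheory.Weil1964
open Literature.AlgebraicGeometry.HodgeTheory
open Literature.NumberTheory.Automorphic.PicardCM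
open HodgeCM.PerL34.Seesaw HodgeCM.PerL34.RationalCoset HodgeCM.PerL34.SupplyAdelic
open HodgeCM.Model.SupplyInstance HodgeCM.Model.SupplyResidual
open HodgeCM.Model.ThetaSpace

namespace HodgeCM
namespace Model

/-! ## §1. Pure-tensor actions read off at any base point and level -/

section ArchTensor

variable {K : Type} [Field K] [NumberField K] {J : Type} [Fintype J] {G : Type*} [Monoid G]

attribute [local instance] SupplyInstance.ratModule

/-- **`ρ` acts on the archimedean tensor factor only**: `ρ(g) = A_g ⊗ 1` on `𝒮(𝔸_K^J) = 𝓢(X_∞) ⊗ 𝒮(X_f)` for some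
linear `A_g` (necessarily unique, `IsArchTensor.archReadRep_apply`). -/
def IsArchTensor (ρ : Representation ℂ G (piSchwartzBruhat K J)) : Prop :=
  ∀ g : G, ∃ A : 𝓢((J → mixedSpace K), ℂ) →ₗ[ℂ] 𝓢((J → mixedSpace K), ℂ),
    ρ g = adelicTensorEnd A LinearMap.id

variable {ρ : Representation ℂ G (piSchwartzBruhat K J)}

/-- `(A ⊗ 1)(φ_N(Φ_∞)) = φ_N(A Φ_∞)` at every base point `x₀` and level `N`: the thin-coset test function is the
pure tensor `Φ_∞ ⊗ 1_{N𝒪̂^J}(−ι_f x₀ + ·)` (tree `thinCosetTestFunₗ_eq_tmul`). -/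
theorem apply_testFun_of_eq_adelicTensorEnd {g : G}
    {A : 𝓢((J → mixedSpace K), ℂ) →ₗ[ℂ] 𝓢((J → mixedSpace K), ℂ)} (hA : ρ g = adelicTensorEnd A LinearMap.id)
    (Φinf : 𝓢((J → mixedSpace K), ℂ)) (x₀ : J → K) (N : ℕ) :
    ρ g (testFun K J Φinf x₀ N) = testFun K J (A Φinf) x₀ N := by
  have e : ∀ Ψ : 𝓢((J → mixedSpace K), ℂ), testFun K J Ψ x₀ N =
      thinCosetTestFunₗ (K := K) (ι := J) (finEmb K J x₀) (Ideal.span {(N : 𝓞 K)}) Ψ := fun _ => rfl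
  rw [e, e, thinCosetTestFunₗ_eq_tmul, thinCosetTestFunₗ_eq_tmul, hA, adelicTensorEnd_apply_tmul,
    LinearMap.id_apply]

/-- A pure-tensor action maps level-`N` thin-coset test functions at `x₀` to the same, for EVERY `(x₀, N)`. -/
theorem IsArchTensor.isArchOnTestFun (h : IsArchTensor ρ) (x₀ : J → K) (N : ℕ) : IsArchOnTestFun ρ x₀ N :=
  fun g Φinf => by
    obtain ⟨A, hA⟩ := h g
    exact ⟨A Φinf, apply_testFun_of_eq_adelicTensorEnd hA Φinf x₀ N⟩

/-- **The read-off IS the archimedean tensor factor**, at any `(x₀, N)`. -/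
theorem IsArchTensor.archReadRep_apply (h : IsArchTensor ρ) (x₀ : J → K) (N : ℕ) {g : G}
    {A : 𝓢((J → mixedSpace K), ℂ) →ₗ[ℂ] 𝓢((J → mixedSpace K), ℂ)} (hA : ρ g = adelicTensorEnd A LinearMap.id)
    (Φinf : 𝓢((J → mixedSpace K), ℂ)) : archReadRep (h.isArchOnTestFun x₀ N) g Φinf = A Φinf :=
  (archReadRep_unique (h.isArchOnTestFun x₀ N) (fun Φ => apply_testFun_of_eq_adelicTensorEnd hA Φ x₀ N) Φinf).symm

/-- **LEVEL INDEPENDENCE of the read-off**: for a pure-tensor action the representations read off at `(x₀, N)` and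
at `(x₀', N')` coincide. -/
theorem IsArchTensor.archReadRep_eq (h : IsArchTensor ρ) (x₀ x₀' : J → K) (N N' : ℕ) :
    archReadRep (h.isArchOnTestFun x₀ N) = archReadRep (h.isArchOnTestFun x₀' N') := by
  refine MonoidHom.ext fun g => LinearMap.ext fun Φinf => ?_
  obtain ⟨A, hA⟩ := h g
  rw [h.archReadRep_apply x₀ N hA, h.archReadRep_apply x₀' N' hA]

end ArchTensor

/-! ## §2. The model: `C.ωinf` does not depend on the level -/

section ModelPin

variable {U : Universe} {Lc : CMField} {ι₁ : Lc →+* ℂ} {V : HermSpace3 Lc ι₁} {c : SeesawCtx Lc}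

namespace ArchKTypeData

variable {X : ThetaSpaceInput U V c} {k : Fin 4} {N N' : ℕ}

/-- For a pure-tensor restriction along `ιinf C.Γ₀`, `C.ωinf` IS the archimedean tensor factor. -/
theorem ωinf_apply_of_eq_adelicTensorEnd (C : ArchKTypeData X k N) {g : X.G₁}
    {A : 𝓢((X.J → mixedSpace X.K), ℂ) →ₗ[ℂ] 𝓢((X.J → mixedSpace X.K), ℂ)}
    (hA : archRestr X k C.Γ₀ g = adelicTensorEnd A LinearMap.id) (Φinf : 𝓢((X.J → mixedSpace X.K), ℂ)) :
    C.ωinf g Φinf = A Φinf :=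
  (C.ωinf_eq_archReadRep g Φinf).trans
    ((archReadRep_unique C.isArchOnTestFun
      (fun Φ => apply_testFun_of_eq_adelicTensorEnd hA Φ (X.P k).x₀ N) Φinf).symm)

/-- **CROSS-LEVEL RIGIDITY of `ωinf`.** Two archimedean `K`-type data over the same theta-space input and index
`k`, at levels `N` and `N'`, with the same archimedean inclusion (`X.ιinf C.Γ₀ = X.ιinf C'.Γ₀`), have the same
archimedean action as soon as the pair action restricted along that inclusion is pure-tensor. -/
theorem ωinf_eq_of_isArchTensor (C : ArchKTypeData X k N) (C' : ArchKTypeData X k N')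
    (hι : X.ιinf C.Γ₀ = X.ιinf C'.Γ₀) (h : IsArchTensor (archRestr X k C.Γ₀)) : C.ωinf = C'.ωinf := by
  refine MonoidHom.ext fun g => LinearMap.ext fun Φinf => ?_
  obtain ⟨A, hA⟩ := h g
  have hA' : archRestr X k C'.Γ₀ g = adelicTensorEnd A LinearMap.id := by
    rw [archRestr_apply, ← hι, ← archRestr_apply, hA]
  rw [C.ωinf_apply_of_eq_adelicTensorEnd hA, C'.ωinf_apply_of_eq_adelicTensorEnd hA']

/-- Under the pure-tensor hypothesis the smart constructor of row #3 may be fed at ANY level from ONE witness. -/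
theorem isArchOnTestFun_archRestr_of_isArchTensor (Γ₀ : Level V) (h : IsArchTensor (archRestr X k Γ₀)) (N : ℕ) :
    IsArchOnTestFun (archRestr X k Γ₀) (X.P k).x₀ N :=
  h.isArchOnTestFun (X.P k).x₀ N

end ArchKTypeData

end ModelPin

/-! ## §3. (AN) and (REP) of `C` are (AN) and (REP) of the archimedean factor -/

section Transfer

variable {U : Universe} {Lc : CMField} {ι₁ : Lc →+* ℂ} {V : HermSpace3 Lc ι₁} {c : SeesawCtx Lc}

namespace ArchKTypeData

variable {X : ThetaSpaceInput U V c} {k : Fin 4} {N : ℕ} (C : ArchKTypeData X k N)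

/-- **(AN) transfers along a pointwise identification of `ωinf`**: if `C.ωinf (e b) = ρ (e b)` pointwise and
`b ↦ T (ρ (e b) Φ)` is real-differentiable at `0` for every continuous functional `T` and every `Φ`, then `C`
is (AN) along `e`. -/
theorem isWeaklyPDiff_of_ωinf_eq {P' : Type*} [NormedAddCommGroup P'] [NormedSpace ℝ P'] {e : P' → X.G₁}
    (ρ : X.G₁ → 𝓢((X.J → mixedSpace X.K), ℂ) →ₗ[ℂ] 𝓢((X.J → mixedSpace X.K), ℂ))
    (hω : ∀ (b : P') (Φ : 𝓢((X.J → mixedSpace X.K), ℂ)), C.ωinf (e b) Φ = ρ (e b) Φ)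
    (h : ∀ (T : 𝓢((X.J → mixedSpace X.K), ℂ) →L[ℂ] ℂ) (Φ : 𝓢((X.J → mixedSpace X.K), ℂ)),
      DifferentiableAt ℝ (fun b => T (ρ (e b) Φ)) 0) :
    C.IsWeaklyPDiff e := fun T ℓ => by
  simp_rw [hω]
  exact h T (C.Φarch ℓ)

/-- **(REP) transfers along a pointwise identification of `ωinf`** (same statement about `ρ` on the harmonic
family `Φarch`). -/
theorem isPMinusKilled_of_ωinf_eq {P' : Type*} [NormedAddCommGroup P'] [NormedSpace ℝ P'] [Module ℂ P']
    {e : P' → X.G₁} (ρ : X.G₁ → 𝓢((X.J → mixedSpace X.K), ℂ) →ₗ[ℂ] 𝓢((X.J → mixedSpace X.K), ℂ))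
    (hω : ∀ (b : P') (Φ : 𝓢((X.J → mixedSpace X.K), ℂ)), C.ωinf (e b) Φ = ρ (e b) Φ)
    (h : ∀ (v : P') (ℓ : Module.Dual ℂ X.W), ∃ D Dᵢ : 𝓢((X.J → mixedSpace X.K), ℂ),
      Tendsto (fun t : ℝ => t⁻¹ • (ρ (e (t • v)) (C.Φarch ℓ) - C.Φarch ℓ)) (𝓝[≠] 0) (𝓝 D) ∧
      Tendsto (fun t : ℝ => t⁻¹ • (ρ (e (t • (Complex.I • v))) (C.Φarch ℓ) - C.Φarch ℓ)) (𝓝[≠] 0)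
        (𝓝 Dᵢ) ∧
      D + Complex.I • Dᵢ = 0) :
    C.IsPMinusKilled e := fun v ℓ => by
  simp_rw [hω]
  exact h v ℓ

/-- **(AN) for a pure-tensor restriction is (AN) of the archimedean tensor factor**: with
`ω(ι_∞ g, 1) = A_g ⊗ 1` along `ιinf C.Γ₀`, differentiability of `b ↦ T (A_{e b} Φ)` at `0` gives `hd` for `C`. -/
theorem isWeaklyPDiff_of_eq_adelicTensorEnd {P' : Type*} [NormedAddCommGroup P'] [NormedSpace ℝ P']
    {e : P' → X.G₁} (A : X.G₁ → 𝓢((X.J → mixedSpace X.K), ℂ) →ₗ[ℂ] 𝓢((X.J → mixedSpace X.K), ℂ))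
    (hA : ∀ g : X.G₁, archRestr X k C.Γ₀ g = adelicTensorEnd (A g) LinearMap.id)
    (h : ∀ (T : 𝓢((X.J → mixedSpace X.K), ℂ) →L[ℂ] ℂ) (Φ : 𝓢((X.J → mixedSpace X.K), ℂ)),
      DifferentiableAt ℝ (fun b => T (A (e b) Φ)) 0) :
    C.IsWeaklyPDiff e :=
  C.isWeaklyPDiff_of_ωinf_eq A (fun b Φ => C.ωinf_apply_of_eq_adelicTensorEnd (hA (e b)) Φ) h

/-- **(REP) for a pure-tensor restriction is (REP) of the archimedean tensor factor.** -/
theorem isPMinusKilled_of_eq_adelicTensorEnd {P' : Type*} [NormedAddCommGroup P'] [NormedSpace ℝ P']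
    [Module ℂ P'] {e : P' → X.G₁}
    (A : X.G₁ → 𝓢((X.J → mixedSpace X.K), ℂ) →ₗ[ℂ] 𝓢((X.J → mixedSpace X.K), ℂ))
    (hA : ∀ g : X.G₁, archRestr X k C.Γ₀ g = adelicTensorEnd (A g) LinearMap.id)
    (h : ∀ (v : P') (ℓ : Module.Dual ℂ X.W), ∃ D Dᵢ : 𝓢((X.J → mixedSpace X.K), ℂ),
      Tendsto (fun t : ℝ => t⁻¹ • (A (e (t • v)) (C.Φarch ℓ) - C.Φarch ℓ)) (𝓝[≠] 0) (𝓝 D) ∧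
      Tendsto (fun t : ℝ => t⁻¹ • (A (e (t • (Complex.I • v))) (C.Φarch ℓ) - C.Φarch ℓ)) (𝓝[≠] 0)
        (𝓝 Dᵢ) ∧
      D + Complex.I • Dᵢ = 0) :
    C.IsPMinusKilled e :=
  C.isPMinusKilled_of_ωinf_eq A (fun b Φ => C.ωinf_apply_of_eq_adelicTensorEnd (hA (e b)) Φ) h

end ArchKTypeData

end Transfer

end Model
end HodgeCM

end
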